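import Literature.MathematicalPhysics.QuantumFieldTheory.Balaban1983to89.B8Prop6CubeMemberOfThm33

/-!
# `Balaban1983to89.B8LeafKnitZd3CubOfThm33` — the re-typed B8 LEAF on an index-mapped sub-family with PROPOSITION 6 SERVED AT THE CUBE
# FAMILIES FROM [4] THEOREM 3.3 BY NAME (the N06 → N05 junction) + Proposition 5's sockets

statement-level skeleton of published theorems with citation tags; proofs where landed; nothing here is a claim about the
Yang–Mills mass gap

`[Balaban1985RegularSpaces]` CMP **99** (1985): Lemma 1 p. 79, Thm 2 p. 83, Prop. 3 p. 87, Thm 4 p. 88, Prop. 5 p. 94, Prop. 6 p. 99, Prop. 7 p. 100,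
Thm 8 p. 101, (1.58)–(1.59) p. 86; [4] = `[Balaban1985BackgroundPropagators]` Thm 3.3 p. 399, (3.27) p. 395.

CITATION HEADER (lean-in-tree rule).  Cell `pub-ymgap` (D-0062), node N05 = [B8], seat `pub-ymgap-dag-n05-e` g7 (R141 (C) row s3b).  WHY: this seat's
`B8LeafKnitZd3CubBdry4.b8LeafRS_zd3_map_of_printed_bdry₅_d4` is the N05 leaf face (`B8LeafRS` on an index-mapped `Ω₀ = ℤᵈ` sub-family with cube index
`f`) with `p6` served from FIVE per-member sockets; `B8Prop6CubeMemberOfThm33.prop6Printed_zdCub_of_thm33` (this seat, on dag-n06-b's junction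
`B9SupplySockB9P3ZdAtFamilies`) serves the two (1.59) sockets from [4] THEOREM 3.3 BY NAME.  THIS FILE composes them: ★★ `b8LeafRS_zd3_map_of_thm33`
— the leaf face whose `p6` slot rests on `B9.Thm33Printed` + the six member-local [4]-letter binders on the cube sub-family + Proposition 5's three
sockets at `(B₀ˢ, B₀′)`, NO «L large» window (the enlarged-constant form `prop6Printed_zdCub_of_thm33'`); the other slots as before (`l1` Lemma 1 = n04's theorem, `t2` n05-a's map-level derivation
from `H4`∕`H3`, `p3`∕`t4`∕`p5e`∕`p5u`∕`p7`∕`t8` printed sentences as named hypotheses).  The Proposition-5 ∕ b9 input pair is any `inp` with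
`inp.B₀ = B₀ˢ = max{1, 2B₀max{1,q}}·max{1, (80d+8)/(dL−1)}` (Thm 3.3's `B₀`, enlarged once for the collar bookkeeping) and `inp.B₀' = B₀′`.  Kind «kernel-checked proof», theorems only, no `def`.

HONEST SCOPE.  Bookkeeping by name; nothing of [4]∕[Balaban1985RegularSpaces] proved; every slot other than `l1`, `t2`, `p6` is a named printed
hypothesis; `p6` rests on `B9.Thm33Printed` + binders + Prop. 5's sockets (hypotheses).  Count-neutral; N05 NOT discharged; one finite `𝕋⁴`
programme at fixed `ε`, Bałaban as printed; nothing continuum ∕ ℝ⁴ ∕ OS ∕ mass-gap ∕ Clay.  No `sorry`, no `def`, no `instance`, no `notation`.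
Unit `pub-ymgap-dag-n05-e` (g7), 2026-08-27.
-/

noncomputable section

open NormedSpace

namespace Literature.MathematicalPhysics.QuantumFieldTheory.Balaban1983to89.B8LeafKnitZd3CubOfThm33

open B7Prop1Explicit B7Prop2Explicit B7Prop1Local B7Eq92Concrete
open B8Lemma1NonAbelian (mulCfg blockPairNA lemma1Printed_blockPairNA)
open B8LeafKnitRS (B8LeafRS)
open B8LeafModelZd (ZdIdx SockP5base SockP5 SockP5u)
open B8LeafModelZd3 (zdGF3)
open B8LeafModelZd3Map (thm2Printed_zd3_map_of_thm4)
open B8Eq131CubesAdmissible (cubeFam)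
open B8CubeMemberZd (cubeLamS cubeLamB)
open B8LeafKnitZd3CubOfPrinted (prop3Printed_of_C₂_le)
open B9SupplySockB9P3ZdLetters (OpsZd)
open B9SupplySockB9P3ZdAt (DictAt Prop6At InvAt CurvAt LandauAt AvgAt)
open B8Prop6CubeMemberOfThm33 (prop6Printed_zdCub_of_thm33')
open Node00 (CubeB8 zdCub)

-- `Site` alone could resolve to the torus sites of `Setup.lean`; re-export the `ℤ^d` sites of `B7Prop1Explicit`.
export B7Prop1Explicit (Site)

variable {d : ℕ}

variable {𝔸 : Type} [CStarAlgebra 𝔸] [Nontrivial 𝔸]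
variable {I₃ : Type} {lan : I₃ → B8.LandauData}

/-! ## The N05 leaf face with Proposition 6 served from Theorem 3.3 by name -/

/-- ★★ **THE RE-TYPED B8 LEAF ON AN INDEX-MAPPED SUB-FAMILY, PROPOSITION 6 SERVED AT THE CUBE FAMILIES FROM [4] THEOREM 3.3 BY NAME**:
`b8LeafRS_zd3_map_of_printed_bdry₅_d4` with its `SH59D` binder and its per-cube four-line socket DISCHARGED through `prop6Printed_zdCub_of_thm33`
— `p6` now rests on `B9.Thm33Printed` + the six member-local [4]-letter binders on the cube sub-family + Proposition 5's three sockets at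
`(inp.B₀, inp.B₀') = (B₀ˢ, B₀′)`, `B₀ˢ = max{1, 2B₀max{1,q}}·max{1, (80d+8)/(dL−1)}` (the window-free form: the collar window is met by
enlarging the constant, `prop6Printed_zdCub_of_thm33'`); all other slots verbatim.
[cite: Balaban1985RegularSpaces, Lemma 1 p.79, Thm 2 p.83, Prop. 3 p.87, Thm 4 p.88, Prop. 6 p.99 (derived); Prop. 5 p.94, Prop. 7 p.100, Thm 8 p.101 (named hypotheses); Balaban1985BackgroundPropagators, Thm 3.3 p.399] -/
theorem b8LeafRS_zd3_map_of_thm33 (hd2 : 2 ≤ d) {L : ℕ} (hL : 2 ≤ L)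
    {I : Type} (geo : I → B9.Geometry) (bg : I → B9.Backgrounds) (GA : ∀ i, B9.KernelFamily (geo i) (bg i))
    (mem : ℝ → ZdIdx d L → ℕ → I)
    (ιCfg : ∀ (M : ℝ) (i : ZdIdx d L) (m : ℕ) (U₀ : Site d → Fin d → 𝔸ˣ), (∀ x κ, U₀ x κ ∈ unitaryUnits 𝔸) → (bg (mem M i m)).Cfg)
    (ιLoc : ∀ (M : ℝ) (i : ZdIdx d L) (m : ℕ), (Site d → Fin d → 𝔸) → (geo (mem M i m)).Loc)
    (ops : ℝ → ZdIdx d L → ℕ → OpsZd d 𝔸) {c35 c₆ K₆ M₃ a₃ c69 q : ℝ}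
    {Gp : ∀ i, B9.KernelFamily (geo i) (bg i)} (h33 : B9.Thm33Printed c35 geo bg Gp GA)
    -- the [4]-letter binders of printed shape AT THE MEMBERS OF THE CUBE SUB-FAMILY ONLY (n06-b's member-local `…At` forms)
    (hdict : ∀ (M : ℝ) (j : {i : ZdIdx d L // ∃ (a : Site d) (M ρ : ℕ), L ≤ ρ ∧ ρ ≤ M ∧ 11 * d < M ∧ L ≤ d * M ∧
          i.Ω = cubeFam false L a M ρ i.k ∧ i.Λs = cubeLamS L a M ρ i.k ∧ i.Λb = cubeLamB L a M ρ i.k}) (m : ℕ),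
      DictAt geo bg GA L mem ιCfg ιLoc ops M j.1 m)
    (hP6 : ∀ (M : ℝ) (j : {i : ZdIdx d L // ∃ (a : Site d) (M ρ : ℕ), L ≤ ρ ∧ ρ ≤ M ∧ 11 * d < M ∧ L ≤ d * M ∧
          i.Ω = cubeFam false L a M ρ i.k ∧ i.Λs = cubeLamS L a M ρ i.k ∧ i.Λb = cubeLamB L a M ρ i.k}) (m : ℕ),
      M₃ ≤ M → Prop6At bg L mem ιCfg c35 c₆ K₆ M j.1 m)
    (hinv : ∀ (M : ℝ) (j : {i : ZdIdx d L // ∃ (a : Site d) (M ρ : ℕ), L ≤ ρ ∧ ρ ≤ M ∧ 11 * d < M ∧ L ≤ d * M ∧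
          i.Ω = cubeFam false L a M ρ i.k ∧ i.Λs = cubeLamS L a M ρ i.k ∧ i.Λb = cubeLamB L a M ρ i.k}) (m : ℕ),
      M₃ ≤ M → InvAt bg L mem ιCfg ops c35 a₃ M j.1 m)
    (hcurv : ∀ (M : ℝ) (j : {i : ZdIdx d L // ∃ (a : Site d) (M ρ : ℕ), L ≤ ρ ∧ ρ ≤ M ∧ 11 * d < M ∧ L ≤ d * M ∧
          i.Ω = cubeFam false L a M ρ i.k ∧ i.Λs = cubeLamS L a M ρ i.k ∧ i.Λb = cubeLamB L a M ρ i.k}) (m : ℕ),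
      M₃ ≤ M → CurvAt bg L mem ιCfg ops c35 a₃ c69 M j.1 m)
    (hlan : ∀ (M : ℝ) (j : {i : ZdIdx d L // ∃ (a : Site d) (M ρ : ℕ), L ≤ ρ ∧ ρ ≤ M ∧ 11 * d < M ∧ L ≤ d * M ∧
          i.Ω = cubeFam false L a M ρ i.k ∧ i.Λs = cubeLamS L a M ρ i.k ∧ i.Λb = cubeLamB L a M ρ i.k}) (m : ℕ),
      M₃ ≤ M → LandauAt bg L mem ιCfg ops c35 a₃ M j.1 m)
    (havg : ∀ (M : ℝ) (j : {i : ZdIdx d L // ∃ (a : Site d) (M ρ : ℕ), L ≤ ρ ∧ ρ ≤ M ∧ 11 * d < M ∧ L ≤ d * M ∧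
          i.Ω = cubeFam false L a M ρ i.k ∧ i.Λs = cubeLamS L a M ρ i.k ∧ i.Λb = cubeLamB L a M ρ i.k}) (m : ℕ),
      AvgAt L ops q M j.1 m)
    (hc₆ : 0 < c₆) (hK₆ : 0 < K₆) (ha₃ : 0 < a₃) (hc69 : 0 ≤ c69) (hq : 0 ≤ q)
    (Lb : ℕ) (β : ℝ) (len : Site d → ℝ) {B₀' B₀β C₂ C₂c cu cP B₂ : ℝ} (hB₀' : 0 < B₀') (hB₀β : 0 < B₀β)
    (hC₂ : 2097152 * ((d : ℝ) + 1) ^ 2 ≤ C₂) (hC₂c : 2097152 * ((d : ℝ) + 1) ^ 2 ≤ C₂c) (hcu : 0 < cu) (hcP : 0 < cP) :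
    ∃ B₀ : ℝ, 0 < B₀ ∧ ∀ (inp : B8.B9Inputs), inp.B₀ = max 1 (2 * B₀ * max 1 q) * max 1 ((80 * (d : ℝ) + 8) / ((d : ℝ) * L - 1)) → inp.B₀' = B₀' →
      ((∀ i : {i : ZdIdx d L // ∃ (a : Site d) (M ρ : ℕ), L ≤ ρ ∧ ρ ≤ M ∧ 11 * d < M ∧ L ≤ d * M ∧
          i.Ω = cubeFam false L a M ρ i.k ∧ i.Λs = cubeLamS L a M ρ i.k ∧ i.Λb = cubeLamB L a M ρ i.k},
          SockP5base (𝔸 := 𝔸) L inp.B₀ inp.B₀' cP i.1.η i.1.k i.1.Ω i.1.Λs) →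
       (∀ i : {i : ZdIdx d L // ∃ (a : Site d) (M ρ : ℕ), L ≤ ρ ∧ ρ ≤ M ∧ 11 * d < M ∧ L ≤ d * M ∧
          i.Ω = cubeFam false L a M ρ i.k ∧ i.Λs = cubeLamS L a M ρ i.k ∧ i.Λb = cubeLamB L a M ρ i.k},
          SockP5 (𝔸 := 𝔸) L inp.B₀ inp.B₀' cP i.1.η i.1.k i.1.Ω i.1.Λs) →
       (∀ i : {i : ZdIdx d L // ∃ (a : Site d) (M ρ : ℕ), L ≤ ρ ∧ ρ ≤ M ∧ 11 * d < M ∧ L ≤ d * M ∧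
          i.Ω = cubeFam false L a M ρ i.k ∧ i.Λs = cubeLamS L a M ρ i.k ∧ i.Λb = cubeLamB L a M ρ i.k},
          SockP5u (𝔸 := 𝔸) L cP cu i.1.η i.1.k i.1.Ω i.1.Λs) →
      ∃ c₁ : ℝ, 0 < c₁ ∧ ∀ {J : Type} (ι : J → ZdIdx d L), (∀ j, (ι j).Ω 0 = Set.univ) →
        B8.Thm4Printed (5 * (d : ℝ) * L * inp.B₀) (fun j : J => (zdGF3 𝔸 L β len (ι j)).toGFData) →
        B8.Prop3Printed d (L : ℝ) (2097152 * ((d : ℝ) + 1) ^ 2) inp B₀β (fun j : J => (zdGF3 𝔸 L β len (ι j)).toGFData2) →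
        ∀ {ι' : Type} (f : ι' → ZdIdx d L),
        ∀ {toAxial : ∀ j : J, (zdGF3 𝔸 L β len (ι j)).Cfg → (zdGF3 𝔸 L β len (ι j)).Pert → (zdGF3 𝔸 L β len (ι j)).Pert},
        B8.Prop5Exists inp.B₀' (5 * (d : ℝ) * L * inp.B₀) lan → B8.Prop5Unique lan →
        B8SectGH.Prop7PrintedR (fun j : J => zdGF3 𝔸 L β len (ι j)) toAxial →
        B8Thm8Surviving.Thm8SurvivingAt 1 (5 * (d : ℝ) * L * inp.B₀) B₂ (fun j : J => zdGF3 𝔸 L β len (ι j)) →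
        B8LeafRS d (L : ℝ) C₂ (5 * (d : ℝ) * L * inp.B₀) inp.B₀' (5 * (d : ℝ) * L * inp.B₀) B₂ c₁ inp B₀β (blockPairNA d Lb 𝔸)
          (fun j : J => zdGF3 𝔸 L β len (ι j)) lan (fun j : ι' => zdCub 𝔸 L (f j)) toAxial) := by
  have hL1 : 1 ≤ L := le_trans (by norm_num) hL
  have hLr : (2 : ℝ) ≤ L := by exact_mod_cast hL
  have hdr : (2 : ℝ) ≤ d := by exact_mod_cast hd2
  obtain ⟨B₀, hB₀, H⟩ := prop6Printed_zdCub_of_thm33' (𝔸 := 𝔸) hd2 hL geo bg GA mem ιCfg ιLoc ops h33 hdict hP6 hinv hcurv hlan havg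
    hc₆ hK₆ ha₃ hc69 hq hB₀' hC₂c hcu hcP
  refine ⟨B₀, hB₀, fun inp hinp hinp' SP5base SP5 SP5u => ?_⟩
  have hB₀D1 : 1 ≤ inp.B₀ := by
    rw [hinp]
    calc (1 : ℝ) = 1 * 1 := by ring
      _ ≤ max 1 (2 * B₀ * max 1 q) * max 1 ((80 * (d : ℝ) + 8) / ((d : ℝ) * L - 1)) :=
          mul_le_mul (le_max_left _ _) (le_max_left _ _) zero_le_one (le_trans zero_le_one (le_max_left _ _))
  have hB : 2 ≤ 5 * (d : ℝ) * L * inp.B₀ := by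
    have h1 : (2 : ℝ) ≤ 5 * (d : ℝ) * L := by nlinarith [hLr, hdr]
    nlinarith [h1, hB₀D1]
  obtain ⟨c₁, hc₁, P6⟩ := H (fun i => by rw [← hinp, ← hinp']; exact SP5base i) (fun i => by rw [← hinp, ← hinp']; exact SP5 i) SP5u
  refine ⟨c₁, hc₁, fun ι hΩ H4 H3 _ f _ p5e p5u p7 t8 => ?_⟩
  have p6 : B8.Prop6Printed d (L : ℝ) (5 * (d : ℝ) * L * inp.B₀) c₁ (fun j => zdCub 𝔸 L (f j)) := by rw [hinp]; exact P6 f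
  exact
    { l1 := lemma1Printed_blockPairNA d Lb 𝔸
      t2 := thm2Printed_zd3_map_of_thm4 hd2 hL inp.B₀_pos inp.B₀'_pos hB₀β hB ι hΩ H4 H3
      p3 := prop3Printed_of_C₂_le hC₂ H3
      t4 := H4
      p5e := p5e
      p5u := p5u
      p6 := p6
      p7 := p7
      t8 := t8 }

#print axioms b8LeafRS_zd3_map_of_thm33

open B9SupplySockB9P3ZdLettersOmega (SockB9P3D4)

/-! ## The binder-agnostic form: the leaf face from ANY all-levels four-line socket family on the cube sub-family -/

/-- ★★ **THE N05 LEAF FACE FROM AN ALL-LEVELS FOUR-LINE SOCKET FAMILY ON THE CUBE SUB-FAMILY — BINDER-AGNOSTIC, WINDOW-FREE**: `b8LeafRS_zd3_map_of_thm33`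
with its junction hypotheses (Thm 3.3 + the member-local binders) replaced by their CONCLUSION, an all-levels family `SockB9P3D4 L B₀ B_∂ cP₉` on the cube
sub-family (`B8Prop6CubeMemberOfThm33.prop6Printed_zdCub_of_sockD4Family`); Proposition 5's sockets at `(inp.B₀, inp.B₀') = (B₀ˢ, B₀′)`,
`B₀ˢ = max{max{1,B₀}, 4B_∂/(dL−1)}`.  Any edition of the N06 junction plugs by one application.
[cite: Balaban1985RegularSpaces, Lemma 1 p.79, Thm 2 p.83, Prop. 3 p.87, Thm 4 p.88, Prop. 6 p.99 (derived); Prop. 5 p.94, Prop. 7 p.100, Thm 8 p.101 (named hypotheses), (1.59) p.86] -/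
theorem b8LeafRS_zd3_map_of_sockD4Family (hd2 : 2 ≤ d) {L : ℕ} (hL : 2 ≤ L) {B₀ Bbd cP₉ : ℝ} (hBbd : 0 ≤ Bbd) (hcP₉ : 0 < cP₉)
    (hall : ∀ (j : {i : ZdIdx d L // ∃ (a : Site d) (M ρ : ℕ), L ≤ ρ ∧ ρ ≤ M ∧ 11 * d < M ∧ L ≤ d * M ∧
          i.Ω = cubeFam false L a M ρ i.k ∧ i.Λs = cubeLamS L a M ρ i.k ∧ i.Λb = cubeLamB L a M ρ i.k}) (m : ℕ), m ≤ j.1.k →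
      SockB9P3D4 (𝔸 := 𝔸) L B₀ Bbd cP₉ j.1.η m j.1.Ω j.1.Λs j.1.Λb)
    (Lb : ℕ) (β : ℝ) (len : Site d → ℝ) {B₀' B₀β C₂ C₂c cu cP B₂ : ℝ} (hB₀' : 0 < B₀') (hB₀β : 0 < B₀β)
    (hC₂ : 2097152 * ((d : ℝ) + 1) ^ 2 ≤ C₂) (hC₂c : 2097152 * ((d : ℝ) + 1) ^ 2 ≤ C₂c) (hcu : 0 < cu) (hcP : 0 < cP) :
    ∀ (inp : B8.B9Inputs), inp.B₀ = max (max 1 B₀) (4 * Bbd / ((d : ℝ) * L - 1)) → inp.B₀' = B₀' →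
      (∀ i : {i : ZdIdx d L // ∃ (a : Site d) (M ρ : ℕ), L ≤ ρ ∧ ρ ≤ M ∧ 11 * d < M ∧ L ≤ d * M ∧
          i.Ω = cubeFam false L a M ρ i.k ∧ i.Λs = cubeLamS L a M ρ i.k ∧ i.Λb = cubeLamB L a M ρ i.k},
          SockP5base (𝔸 := 𝔸) L inp.B₀ inp.B₀' cP i.1.η i.1.k i.1.Ω i.1.Λs) →
       (∀ i : {i : ZdIdx d L // ∃ (a : Site d) (M ρ : ℕ), L ≤ ρ ∧ ρ ≤ M ∧ 11 * d < M ∧ L ≤ d * M ∧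
          i.Ω = cubeFam false L a M ρ i.k ∧ i.Λs = cubeLamS L a M ρ i.k ∧ i.Λb = cubeLamB L a M ρ i.k},
          SockP5 (𝔸 := 𝔸) L inp.B₀ inp.B₀' cP i.1.η i.1.k i.1.Ω i.1.Λs) →
       (∀ i : {i : ZdIdx d L // ∃ (a : Site d) (M ρ : ℕ), L ≤ ρ ∧ ρ ≤ M ∧ 11 * d < M ∧ L ≤ d * M ∧
          i.Ω = cubeFam false L a M ρ i.k ∧ i.Λs = cubeLamS L a M ρ i.k ∧ i.Λb = cubeLamB L a M ρ i.k},
          SockP5u (𝔸 := 𝔸) L cP cu i.1.η i.1.k i.1.Ω i.1.Λs) →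
      ∃ c₁ : ℝ, 0 < c₁ ∧ ∀ {J : Type} (ι : J → ZdIdx d L), (∀ j, (ι j).Ω 0 = Set.univ) →
        B8.Thm4Printed (5 * (d : ℝ) * L * inp.B₀) (fun j : J => (zdGF3 𝔸 L β len (ι j)).toGFData) →
        B8.Prop3Printed d (L : ℝ) (2097152 * ((d : ℝ) + 1) ^ 2) inp B₀β (fun j : J => (zdGF3 𝔸 L β len (ι j)).toGFData2) →
        ∀ {ι' : Type} (f : ι' → ZdIdx d L),
        ∀ {toAxial : ∀ j : J, (zdGF3 𝔸 L β len (ι j)).Cfg → (zdGF3 𝔸 L β len (ι j)).Pert → (zdGF3 𝔸 L β len (ι j)).Pert},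
        B8.Prop5Exists inp.B₀' (5 * (d : ℝ) * L * inp.B₀) lan → B8.Prop5Unique lan →
        B8SectGH.Prop7PrintedR (fun j : J => zdGF3 𝔸 L β len (ι j)) toAxial →
        B8Thm8Surviving.Thm8SurvivingAt 1 (5 * (d : ℝ) * L * inp.B₀) B₂ (fun j : J => zdGF3 𝔸 L β len (ι j)) →
        B8LeafRS d (L : ℝ) C₂ (5 * (d : ℝ) * L * inp.B₀) inp.B₀' (5 * (d : ℝ) * L * inp.B₀) B₂ c₁ inp B₀β (blockPairNA d Lb 𝔸)
          (fun j : J => zdGF3 𝔸 L β len (ι j)) lan (fun j : ι' => zdCub 𝔸 L (f j)) toAxial := by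
  have hLr : (2 : ℝ) ≤ L := by exact_mod_cast hL
  have hdr : (2 : ℝ) ≤ d := by exact_mod_cast hd2
  intro inp hinp hinp' SP5base SP5 SP5u
  have hB₀D1 : 1 ≤ inp.B₀ := by rw [hinp]; exact (le_max_left 1 B₀).trans (le_max_left _ _)
  have hB : 2 ≤ 5 * (d : ℝ) * L * inp.B₀ := by
    have h1 : (2 : ℝ) ≤ 5 * (d : ℝ) * L := by nlinarith [hLr, hdr]
    nlinarith [h1, hB₀D1]
  obtain ⟨c₁, hc₁, P6⟩ := B8Prop6CubeMemberOfThm33.prop6Printed_zdCub_of_sockD4Family (𝔸 := 𝔸) hd2 hL (C₂ := C₂c) hBbd hcP₉ hB₀' hC₂c hcu hcP hall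
    (fun i => by rw [← hinp, ← hinp']; exact SP5base i) (fun i => by rw [← hinp, ← hinp']; exact SP5 i) SP5u
  refine ⟨c₁, hc₁, fun ι hΩ H4 H3 _ f _ p5e p5u p7 t8 => ?_⟩
  have p6 : B8.Prop6Printed d (L : ℝ) (5 * (d : ℝ) * L * inp.B₀) c₁ (fun j => zdCub 𝔸 L (f j)) := by rw [hinp]; exact P6 f
  exact
    { l1 := lemma1Printed_blockPairNA d Lb 𝔸
      t2 := thm2Printed_zd3_map_of_thm4 hd2 hL inp.B₀_pos inp.B₀'_pos hB₀β hB ι hΩ H4 H3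
      p3 := prop3Printed_of_C₂_le hC₂ H3
      t4 := H4
      p5e := p5e
      p5u := p5u
      p6 := p6
      p7 := p7
      t8 := t8 }

#print axioms b8LeafRS_zd3_map_of_sockD4Family

end Literature.MathematicalPhysics.QuantumFieldTheory.Balaban1983to89.B8LeafKnitZd3CubOfThm33

end
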